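import Summits.QuantumFields.YangMills.Theorems.ShellRigidity.Negative.PlanarThresholdSharp

/-!
# The planar threshold `σ = 8` is sharp (II): pointwise four-mirror positivity of `F₈`
# (negative knowledge for crux `PencilRigidity.ShellRigidity`, stmt-QuantumFields-11685; cycle 2)

* `sum_mul_mul_nonneg_of_laplaceRep` — TOOL (both lanes): a planar kernel with a Laplace–Fourier
  representation `F(ε+t,b) = ∫e^{-tp₀+ibp₁}dμ` (`t ≥ 0`) by a finite positive measure carried by
  `{p₀ ≥ 0}` is pointwise OS-positive: `ΣcᵢcⱼF(ε+τᵢ+τⱼ, sᵢ−sⱼ) = ∫|Σcᵢe^{-τᵢp₀+isᵢp₁}|²dμ ≥ 0`.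
* `IsPlanarMirrorKernel` — VERBATIM the ideas' hypothesis package (IdeatorSketch1.lean of the crux
  workfiles; cards `rapidity-liouville-spin-cutoff`, `transverse-smearing-planar-threshold`): continuous off
  `0`, order `σ`, `D₄`, pointwise OS-positive across `t = 0` and across `t = s`.
* `isPlanarMirrorKernel_F8` — `F₈ = cos(8φ)/r⁸` (from part I) is such a kernel with `σ = 8` (axis
  positivity from the representation of part I; diagonal positivity = axis positivity in light-cone
  coordinates because `F₈ ∘ L = F₈`).
* `not_planarShellRigidityLe8` — hence the transfer target `C⁺ = PlanarShellRigidity` (`σ < 8 ⇒` radial)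
  is sharp: with `σ ≤ 8` it is false. This is the 2D shadow of the crux's `η > 0` in the exact pointwise
  form in which the crux itself is typed. No Theses declaration is asserted positively.
-/

namespace Summit.QuantumFields.YangMills.Theorems.ShellRigidity.Negative

open scoped BigOperators ComplexConjugate NNReal ENNReal
open MeasureTheory Complex Set

noncomputable section

local notation "E4" => EuclideanSpace ℝ (Fin 4)

/-! ## From Laplace–Fourier representations to POINTWISE mirror positivity, and the sharpness of the
planar transfer target `C⁺ = PlanarShellRigidity` at `σ = 8` -/

/-- **A Laplace–Fourier-represented kernel is pointwise OS-positive.** If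
`F(ε + t, b) = ∫ e^{-t p₀ + i b p₁} dμ` (`t ≥ 0`) for a finite positive measure `μ` carried by `{p₀ ≥ 0}`,
then `Σᵢⱼ cᵢcⱼ F(ε + τᵢ + τⱼ, sᵢ − sⱼ) = ∫ |Σᵢ cᵢ e^{-τᵢp₀ + i sᵢ p₁}|² dμ ≥ 0` for `τᵢ ≥ 0`.
(The easy half of the kernel-level OS/BCR correspondence; tool for both lanes.) [folklore] -/
theorem sum_mul_mul_nonneg_of_laplaceRep (F : ℝ × ℝ → ℝ) (ε : ℝ) (μ : Measure E4) [IsFiniteMeasure μ]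
    (hμ : μ {p | p 0 < 0} = 0)
    (hrep : ∀ t : ℝ, 0 ≤ t → ∀ b : ℝ, ((F (ε + t, b) : ℝ) : ℂ) =
      ∫ p, cexp ((((-(t * p 0) : ℝ)) : ℂ) + ((b * p 1 : ℝ) : ℂ) * I) ∂μ)
    {m : ℕ} (τ s c : Fin m → ℝ) (hτ : ∀ i, 0 ≤ τ i) :
    0 ≤ ∑ i, ∑ j, c i * c j * F (ε + (τ i + τ j), s i - s j) := by
  set g : Fin m → E4 → ℂ := fun i q => cexp ((((-(τ i * q 0)) : ℝ) : ℂ) + ((s i * q 1 : ℝ) : ℂ) * I)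
    with hg
  have hae : ∀ᵐ q ∂μ, 0 ≤ q 0 := by
    rw [ae_iff]
    have : {q : E4 | ¬ 0 ≤ q 0} = {q | q 0 < 0} := by ext q; simp [not_le]
    rw [this]; exact hμ
  have hgc : ∀ i, Continuous (g i) := by intro i; simp only [hg]; fun_prop
  have hgb : ∀ i, ∀ᵐ q ∂μ, ‖g i q‖ ≤ 1 := by
    intro i
    filter_upwards [hae] with q hq
    simp only [hg, Complex.norm_exp, Complex.add_re, Complex.ofReal_re, Complex.mul_re, Complex.I_re,
      Complex.I_im, Complex.ofReal_im, mul_zero, zero_mul, sub_zero, add_zero, Real.exp_le_one_iff]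
    nlinarith [hτ i]
  have hint : ∀ i j, Integrable (fun q => g i q * conj (g j q)) μ := by
    intro i j
    refine Integrable.of_bound
      (((hgc i).mul (Complex.continuous_conj.comp (hgc j))).aestronglyMeasurable) 1 ?_
    filter_upwards [hgb i, hgb j] with q hi hj
    rw [norm_mul, Complex.norm_conj]
    nlinarith [norm_nonneg (g i q), norm_nonneg (g j q)]
  -- the `(i,j)` integrand of `hrep` is `gᵢ · conj gⱼ`
  have hker : ∀ i j (q : E4),
      cexp ((((-((τ i + τ j) * q 0)) : ℝ) : ℂ) + (((s i - s j) * q 1 : ℝ) : ℂ) * I)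
        = g i q * conj (g j q) := by
    intro i j q
    simp only [hg, ← Complex.exp_conj, ← Complex.exp_add, map_add, map_mul, Complex.conj_ofReal,
      Complex.conj_I]
    congr 1
    push_cast; ring
  have hrep' : ∀ i j, ((F (ε + (τ i + τ j), s i - s j) : ℝ) : ℂ) = ∫ q, g i q * conj (g j q) ∂μ := by
    intro i j
    rw [hrep _ (add_nonneg (hτ i) (hτ j))]
    exact integral_congr_ae (ae_of_all _ (hker i j))
  -- pointwise: `Σᵢⱼ cᵢcⱼ gᵢ conj gⱼ = |Σ cᵢgᵢ|²`
  have hpt : ∀ q : E4, ∑ i, ∑ j, (c i : ℂ) * (c j : ℂ) * (g i q * conj (g j q))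
      = ((Complex.normSq (∑ i, (c i : ℂ) * g i q) : ℝ) : ℂ) := by
    intro q
    rw [← Complex.mul_conj, map_sum, Finset.sum_mul_sum]
    refine Finset.sum_congr rfl fun i _ => Finset.sum_congr rfl fun j _ => ?_
    simp only [map_mul, Complex.conj_ofReal]; ring
  have hsum : (((∑ i, ∑ j, c i * c j * F (ε + (τ i + τ j), s i - s j)) : ℝ) : ℂ)
      = ((∫ q, Complex.normSq (∑ i, (c i : ℂ) * g i q) ∂μ : ℝ) : ℂ) := by
    push_cast
    simp_rw [hrep', ← integral_const_mul]
    rw [← integral_complex_ofReal]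
    simp_rw [← hpt]
    rw [integral_finsetSum _ (fun i _ => integrable_finsetSum _ (fun j _ => (hint i j).const_mul _))]
    refine Finset.sum_congr rfl fun i _ => ?_
    rw [integral_finsetSum _ (fun j _ => (hint i j).const_mul _)]
  have hreal := Complex.ofReal_injective hsum
  rw [hreal]
  exact integral_nonneg fun q => Complex.normSq_nonneg _

/-- Verbatim `IsPlanarMirrorKernel` of the crux ideas (IdeatorSketch1.lean, cards
`rapidity-liouville-spin-cutoff` / `transverse-smearing-planar-threshold`): a planar four-mirror kernel of
order `σ` — continuous off `0`, `|F x| ≤ C(1 + |x|^{-σ})`, `D₄`-symmetric, POINTWISE OS-positive across the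
axis mirror `t = 0` (reflection `(t,s) ↦ (−t,s)`, side `t > 0`) and across the diagonal mirror `t = s`
(reflection `(t,s) ↦ (s,t)`, side `t > s`). -/
def IsPlanarMirrorKernel (F : ℝ × ℝ → ℝ) (σ : ℝ) : Prop :=
  ContinuousOn F {x | x ≠ 0} ∧
  (∃ C : ℝ, ∀ x : ℝ × ℝ, x ≠ 0 → |F x| ≤ C * (1 + (x.1 ^ 2 + x.2 ^ 2) ^ (-(σ / 2)))) ∧
  (∀ t s : ℝ, F (t, s) = F (s, t) ∧ F (t, s) = F (t, -s) ∧ F (t, s) = F (-t, s)) ∧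
  (∀ (m : ℕ) (x : Fin m → ℝ × ℝ) (c : Fin m → ℝ), (∀ i, 0 < (x i).1) →
      0 ≤ ∑ i, ∑ j, c i * c j * F (-(x i).1 - (x j).1, (x i).2 - (x j).2)) ∧
  (∀ (m : ℕ) (x : Fin m → ℝ × ℝ) (c : Fin m → ℝ), (∀ i, (x i).2 < (x i).1) →
      0 ≤ ∑ i, ∑ j, c i * c j * F ((x i).2 - (x j).1, (x i).1 - (x j).2))

/-- Pointwise OS-positivity of `F₈` across the axis mirror `t = 0`. [folklore] -/
theorem F8_axis_pointwise (m : ℕ) (x : Fin m → ℝ × ℝ) (c : Fin m → ℝ) (hx : ∀ i, 0 < (x i).1) :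
    0 ≤ ∑ i, ∑ j, c i * c j * F8 (-(x i).1 - (x j).1, (x i).2 - (x j).2) := by
  rcases isEmpty_or_nonempty (Fin m) with hm | hm
  · simp
  -- ε := the least time coordinate; representation at `ε/2`, `τᵢ := tᵢ − ε/4 ≥ 0`
  obtain ⟨i₀, -, hi₀⟩ := Finset.exists_min_image Finset.univ (fun i => (x i).1) Finset.univ_nonempty
  set ε : ℝ := (x i₀).1 with hε
  have hεpos : 0 < ε := hx i₀
  have hεle : ∀ i, ε ≤ (x i).1 := fun i => hi₀ i (Finset.mem_univ i)
  haveI := isFiniteMeasure_mu8 (half_pos hεpos)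
  have key := sum_mul_mul_nonneg_of_laplaceRep F8 (ε / 2) (mu8 (ε / 2)) (mu8_neg0 _)
    (fun t ht b => (integral_mu8 (half_pos hεpos) ht b).symm)
    (fun i => (x i).1 - ε / 4) (fun i => (x i).2) c (fun i => by linarith [hεle i])
  refine key.trans_eq (Finset.sum_congr rfl fun i _ => Finset.sum_congr rfl fun j _ => ?_)
  have h1 : ε / 2 + ((x i).1 - ε / 4 + ((x j).1 - ε / 4)) = -(-(x i).1 - (x j).1) := by ring
  rw [h1, F8_neg_fst]

/-- Pointwise OS-positivity of `F₈` across the diagonal mirror `t = s`: in light-cone coordinates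
`uᵢ = (tᵢ − sᵢ)/√2 > 0`, `wᵢ = (tᵢ + sᵢ)/√2` it is axis positivity, because `F₈ ∘ L = F₈`. [folklore] -/
theorem F8_diag_pointwise (m : ℕ) (x : Fin m → ℝ × ℝ) (c : Fin m → ℝ) (hx : ∀ i, (x i).2 < (x i).1) :
    0 ≤ ∑ i, ∑ j, c i * c j * F8 ((x i).2 - (x j).1, (x i).1 - (x j).2) := by
  have hs : 0 < Real.sqrt 2 := Real.sqrt_pos.2 two_pos
  set y : Fin m → ℝ × ℝ := fun i => (((x i).1 - (x i).2) / Real.sqrt 2, ((x i).1 + (x i).2) / Real.sqrt 2)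
    with hy
  have hy1 : ∀ i, 0 < (y i).1 := fun i => div_pos (by linarith [hx i]) hs
  refine (F8_axis_pointwise m y c hy1).trans_eq
    (Finset.sum_congr rfl fun i _ => Finset.sum_congr rfl fun j _ => ?_)
  congr 1
  -- F8 (−uᵢ − uⱼ, wᵢ − wⱼ) = F8 (sᵢ − tⱼ, tᵢ − sⱼ)
  have h1 : F8 (-(y i).1 - (y j).1, (y i).2 - (y j).2) = F8 ((y i).2 - (y j).2, (y i).1 + (y j).1) := by
    rw [show -(y i).1 - (y j).1 = -((y i).1 + (y j).1) by ring, F8_neg_fst, F8_swap]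
  rw [h1, ← F8_diag ((y i).2 - (y j).2) ((y i).1 + (y j).1),
    F8_swap ((x i).1 - (x j).2) ((x i).2 - (x j).1)]
  congr 1
  refine Prod.ext ?_ ?_
  · show ((y i).2 - (y j).2 + ((y i).1 + (y j).1)) / Real.sqrt 2 = (x i).1 - (x j).2
    simp only [hy]
    rw [← sub_div, ← add_div, ← add_div, div_div, Real.mul_self_sqrt two_pos.le]
    ring
  · show ((y i).2 - (y j).2 - ((y i).1 + (y j).1)) / Real.sqrt 2 = (x i).2 - (x j).1
    simp only [hy]
    rw [← sub_div, ← add_div, ← sub_div, div_div, Real.mul_self_sqrt two_pos.le]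
    ring

/-- `F₈` is a planar four-mirror kernel of order exactly `8`. [folklore] -/
theorem isPlanarMirrorKernel_F8 : IsPlanarMirrorKernel F8 8 :=
  ⟨continuousOn_F8, ⟨1, abs_F8_le⟩, F8_symm, F8_axis_pointwise, F8_diag_pointwise⟩

/-- The planar transfer target `C⁺ = PlanarShellRigidity` of the crux ideas with `σ < 8` relaxed to
`σ ≤ 8`. -/
def PlanarShellRigidityLe8 : Prop :=
  ∀ (F : ℝ × ℝ → ℝ) (σ : ℝ), IsPlanarMirrorKernel F σ → σ ≤ 8 →
    ∀ r φ : ℝ, 0 < r → F (r * Real.cos φ, r * Real.sin φ) = F (r, 0)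

/-- **`C⁺` is sharp at `σ = 8`** (the planar shadow of the crux's `η > 0`): `F₈ = cos(8φ)/r⁸` is a planar
four-mirror kernel of order `8` — continuous off `0`, `D₄`-symmetric, POINTWISE OS-positive across `t = 0`
and across `t = s` for all finite configurations — and is not radial. [folklore] -/
theorem not_planarShellRigidityLe8 : ¬ PlanarShellRigidityLe8 := by
  intro h
  have key := h F8 8 isPlanarMirrorKernel_F8 le_rfl 1 (Real.pi / 8) one_pos
  rw [F8_dir_pi_div_eight, F8_one_zero] at key
  norm_num at key

end

end Summit.QuantumFields.YangMills.Theorems.ShellRigidity.Negative
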